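import Summits.BirchSwinnertonDyer.BirchSwinnertonDyer.Theses.TwoAdicConverse
import Literature.NumberTheory.EllipticCurves.PrimeConductorTorsionLValue
import Literature.NumberTheory.EllipticCurves.TwoAdicImageQuadraticTwistProofs
import Literature.NumberTheory.EllipticCurves.BSDSelmerParityDokchitserProofs
import HarnessLib

/-!
# Route `TwoAdicConverse` (rung S3): the CONTENT LOCUS of the leaf and of its three cruxes is `{r_an ≥ 2}` —
# exact kernel forms modulo Gross–Zagier–Kolyvagin (and Monsky's `2`-parity for the rank-split), and the
# prime-conductor (β)-family of GEN 23 never meets it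

Cell `bsd-2adic`, seat `bsd-2adic-conv-1` (GEN 23). THEOREMS ONLY — nothing asserted, no definition, no named fact
introduced (the displayed hypotheses are the tree's `rank_eq_analyticRank_of_analyticRank_le_one` = GZK,
`monsky_selmerCorank_two_mod_two_eq` = Monsky's `2`-parity, and for §3 the GEN 23 Mazur fact + modularity).
Sequel of `TwoAdicConverseGoodOrdinaryEvenRankForm.lean` (conv-1, the `r = 0` good-ordinary crux: «content lives in
EVEN analytic rank `≥ 2`») — here for the LEAF `Rank1Residual.NonCMTwoConverse` (item of record of rung S3), for the
rank-`1` residual `RankOneTwoConverse` (19220) and for the multiplicative crux (19219), so that the tribunal / pen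
read each S3 statement as a piece of ONE inequality: BSD's weak rank inequality `corank_{ℤ₂} Sel_{2^∞}(E/ℚ) ≥ 2`
(resp. `≥ 3`) on the part of the habitat where `ord_{s=1} L(E,s) ≥ 2` (resp. is odd `≥ 3`).

* §1 `nonCMTwoConverse_iff_two_le_selmerCorank_of_two_le_analyticRank` — modulo GZK: the leaf ⟺ every non-CM
  globally minimal `W`, good ordinary or multiplicative at `2`, with `r_an(W) ≥ 2` has `corank_{ℤ₂} Sel_{2^∞}(W) ≥ 2`.
  (⇒) needs nothing: corank `≤ 1` would give `r_an = corank ≤ 1` by the leaf. (⇐) on `r_an ≤ 1` the leaf is GZK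
  (`selmerCorank_eq_analyticRank_of_analyticRank_le_one`: corank `= r_an`), on `r_an ≥ 2` the hypothesis kills
  `corank ≤ 1`. No parity is used.
* §1 `nonCMTwoConverse_iff_cruxes` — the leaf ⟺ the conjunction of the three cruxes (unconditional; ⇐ is the route's
  Assembly, ⇒ is bookkeeping), and `rankOneTwoConverse_iff_selmerCorank_ne_one_of_two_le_analyticRank` — modulo GZK
  the rank-`1` residual ⟺ «`r_an ≥ 2` ⇒ corank `≠ 1`».
* §2 WITH Monsky's `2`-parity the locus splits by the parity of `r_an`: the two rank-`0` cruxes live on EVEN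
  `r_an ≥ 2` (`multiplicativeRankZeroTwoConverse_iff_two_le_selmerCorank_of_even_analyticRank`, mirror of the
  good-ordinary theorem of `…EvenRankForm`), the rank-`1` residual lives on ODD `r_an ≥ 3`
  (`rankOneTwoConverse_iff_three_le_selmerCorank_of_odd_analyticRank`: there it says corank `≥ 3`), and the leaf is
  «even `r_an ≥ 2` ⇒ corank `≥ 2`» ∧ «odd `r_an ≥ 3` ⇒ corank `≥ 3`» (`nonCMTwoConverse_iff_of_monsky`).
* §3 The GEN 23 family misses the locus: a curve of PRIME conductor with a rational point of order `2` has
  `r_an = 0` (same derivation as `TwoAdicPrimeConductor.analyticRank_eq_zero_of_prime_conductorNorm_of_hasRationalTwoTorsionX`,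
  Mazur 1977 II (18.10) + modularity; re-derived here in three lines to keep this file's imports route-independent), so `¬ 2 ≤ r_an` there (`not_two_le_analyticRank_of_prime_conductorNorm_of_hasRationalTwoTorsionX`):
  no counterexample to any S3 statement has prime conductor and a rational `2`-torsion point.

HONEST FRAMING: reformulations and one exclusion; every S3 item stays OPEN; BSD is not proved by any of this.
PARTITION (D-0054): none — RANK axis (S3); types-the-object-of. References: [DokchitserDokchitserAnnals2010] Thm. 1.4,
§4.6 (p = 2: Monsky 1996); [Darmon2004] Thm. 3.22 (GZK); [GreenbergLNM1716] §1; [Mazur1977] II Thm. (18.10).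
-/

set_option linter.dupNamespace false
set_option autoImplicit false

noncomputable section

open scoped Classical
open WeierstrassCurve Literature.NumberTheory.EllipticCurves Literature.NumberTheory.EllipticCurves.ModularForms
  Literature.NumberTheory.EllipticCurves.Greenberg1999 Literature.NumberTheory.EllipticCurves.Rank1Residual
  Summit.BirchSwinnertonDyer.BirchSwinnertonDyer.Rank1Residual
  Summit.BirchSwinnertonDyer.BirchSwinnertonDyer.Theses.TwoAdicConverse

namespace Summit.BirchSwinnertonDyer.BirchSwinnertonDyer.Theorems.TwoAdicContentLocus

/-! ## §1. The leaf modulo Gross–Zagier–Kolyvagin: content locus `{r_an ≥ 2}` -/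

/-- **Content locus of the S3 leaf.** Modulo Gross–Zagier–Kolyvagin (`hGZK`): `NonCMTwoConverse` ⟺ every non-CM
globally minimal `W`, good ordinary or multiplicative at `2`, with `ord_{s=1} L(W,s) ≥ 2` has
`corank_{ℤ₂} Sel_{2^∞}(W/ℚ) ≥ 2`. (⇒) is unconditional; (⇐) uses `corank = r_an` on `r_an ≤ 1`
(`selmerCorank_eq_analyticRank_of_analyticRank_le_one`). [cite: Darmon2004, Thm. 3.22] [cite: GreenbergLNM1716, §1 pp. 54–57] -/
theorem nonCMTwoConverse_iff_two_le_selmerCorank_of_two_le_analyticRank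
    (hGZK : rank_eq_analyticRank_of_analyticRank_le_one) :
    NonCMTwoConverse ↔
      ∀ (W : WeierstrassCurve ℚ) [W.IsElliptic] [W.IsGloballyMinimal], ¬ W.HasCM → (GoodOrd W 2 ∨ Mult W 2) →
        2 ≤ W.analyticRank → 2 ≤ W.selmerCorank 2 := by
  constructor
  · intro h W _ _ hcm h2 hr
    by_contra hs
    have hle : W.selmerCorank 2 ≤ 1 := by omega
    have := h W hcm h2 (W.selmerCorank 2) hle rfl
    omega
  · intro h W _ _ hcm h2 r hr hs
    rcases Nat.lt_or_ge W.analyticRank 2 with hlt | hge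
    · have := selmerCorank_eq_analyticRank_of_analyticRank_le_one hGZK W 2 (by omega)
      omega
    · have := h W hcm h2 hge
      omega

/-- The unconditional half on its own: the leaf forces `corank_{ℤ₂} Sel_{2^∞} ≥ 2` wherever `r_an ≥ 2` on its habitat.
[folklore] -/
theorem two_le_selmerCorank_of_two_le_analyticRank_of_nonCMTwoConverse (h : NonCMTwoConverse)
    (W : WeierstrassCurve ℚ) [W.IsElliptic] [W.IsGloballyMinimal] (hcm : ¬ W.HasCM) (h2 : GoodOrd W 2 ∨ Mult W 2)
    (hr : 2 ≤ W.analyticRank) : 2 ≤ W.selmerCorank 2 := by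
  by_contra hs
  have := h W hcm h2 (W.selmerCorank 2) (by omega) rfl
  omega

/-- **The leaf is the conjunction of its three cruxes** (unconditional bookkeeping; ⇐ is the route's Assembly by cases
on `r ≤ 1` and the reduction type, ⇒ specialises the leaf). [folklore] -/
theorem nonCMTwoConverse_iff_cruxes :
    NonCMTwoConverse ↔
      GoodOrdinaryRankZeroTwoConverse ∧ MultiplicativeRankZeroTwoConverse ∧ RankOneTwoConverse := by
  constructor
  · intro h
    refine ⟨fun W _ _ hcm hgo hs => h W hcm (Or.inl hgo) 0 (by omega) hs,
      fun W _ _ hcm hm hs => h W hcm (Or.inr hm) 0 (by omega) hs,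
      fun W _ _ hcm h2 hs => h W hcm h2 1 le_rfl hs⟩
  · rintro ⟨h0o, h0m, h1⟩ W _ _ hcm h2 r hr hs
    rcases Nat.le_one_iff_eq_zero_or_eq_one.mp hr with rfl | rfl
    · rcases h2 with hgo | hm
      · exact h0o W hcm hgo hs
      · exact h0m W hcm hm hs
    · exact h1 W hcm h2 hs

/-- **Content locus of the rank-`1` residual** (19220). Modulo GZK: `RankOneTwoConverse` ⟺ every non-CM globally
minimal `W`, good ordinary or multiplicative at `2`, with `r_an(W) ≥ 2` has `corank_{ℤ₂} Sel_{2^∞}(W/ℚ) ≠ 1`.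
[cite: Darmon2004, Thm. 3.22] [cite: GreenbergLNM1716, §1 pp. 54–57] -/
theorem rankOneTwoConverse_iff_selmerCorank_ne_one_of_two_le_analyticRank
    (hGZK : rank_eq_analyticRank_of_analyticRank_le_one) :
    RankOneTwoConverse ↔
      ∀ (W : WeierstrassCurve ℚ) [W.IsElliptic] [W.IsGloballyMinimal], ¬ W.HasCM → (GoodOrd W 2 ∨ Mult W 2) →
        2 ≤ W.analyticRank → W.selmerCorank 2 ≠ 1 := by
  constructor
  · intro h W _ _ hcm h2 hr hs
    have := h W hcm h2 hs
    omega
  · intro h W _ _ hcm h2 hs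
    rcases Nat.lt_or_ge W.analyticRank 2 with hlt | hge
    · have := selmerCorank_eq_analyticRank_of_analyticRank_le_one hGZK W 2 (by omega)
      omega
    · exact absurd hs (h W hcm h2 hge)

/-- **Content locus of the rank-`0` cruxes, reduction type by type** (tautological contrapositives, no input):
`GoodOrdinaryRankZeroTwoConverse ∧ MultiplicativeRankZeroTwoConverse` ⟺ every non-CM globally minimal `W`, good
ordinary or multiplicative at `2`, with `r_an(W) ≥ 1` has corank `≥ 1`. [folklore] -/
theorem rankZeroCruxes_iff_pos_selmerCorank_of_pos_analyticRank :
    (GoodOrdinaryRankZeroTwoConverse ∧ MultiplicativeRankZeroTwoConverse) ↔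
      ∀ (W : WeierstrassCurve ℚ) [W.IsElliptic] [W.IsGloballyMinimal], ¬ W.HasCM → (GoodOrd W 2 ∨ Mult W 2) →
        1 ≤ W.analyticRank → 1 ≤ W.selmerCorank 2 := by
  constructor
  · rintro ⟨h0o, h0m⟩ W _ _ hcm h2 hr
    by_contra hs
    have hs0 : W.selmerCorank 2 = 0 := by omega
    rcases h2 with hgo | hm
    · have := h0o W hcm hgo hs0; omega
    · have := h0m W hcm hm hs0; omega
  · intro h
    refine ⟨fun W _ _ hcm hgo hs => ?_, fun W _ _ hcm hm hs => ?_⟩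
    · by_contra hr
      have := h W hcm (Or.inl hgo) (by omega); omega
    · by_contra hr
      have := h W hcm (Or.inr hm) (by omega); omega

/-! ## §2. With Monsky's `2`-parity: the locus splits by the parity of `r_an` -/

/-- **Even-rank form of the multiplicative rank-`0` crux** (19219), mirror of conv-1's good-ordinary
`…EvenRankForm`: modulo Monsky's congruence `corank_{ℤ₂} Sel_{2^∞} ≡ r_an (mod 2)` (`hMon`),
`MultiplicativeRankZeroTwoConverse` ⟺ every non-CM globally minimal `W` multiplicative at `2` of EVEN analytic rank
`≥ 2` has corank `≥ 2`. [cite: DokchitserDokchitserAnnals2010, Thm. 1.4 and §4.6 (case p = 2)] -/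
theorem multiplicativeRankZeroTwoConverse_iff_two_le_selmerCorank_of_even_analyticRank
    (hMon : monsky_selmerCorank_two_mod_two_eq) :
    MultiplicativeRankZeroTwoConverse ↔
      ∀ (W : WeierstrassCurve ℚ) [W.IsElliptic] [W.IsGloballyMinimal], ¬ W.HasCM → Mult W 2 →
        Even W.analyticRank → 2 ≤ W.analyticRank → 2 ≤ W.selmerCorank 2 := by
  constructor
  · intro h W _ _ hcm hm hev hr
    have hpar : W.selmerCorank 2 % 2 = W.analyticRank % 2 := hMon W
    have hev' : W.analyticRank % 2 = 0 := Nat.even_iff.mp hev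
    by_contra hs
    have hs01 : W.selmerCorank 2 = 0 ∨ W.selmerCorank 2 = 1 := by omega
    rcases hs01 with h0 | h1
    · have := h W hcm hm h0
      omega
    · omega
  · intro h W _ _ hcm hm hs
    have hpar : W.selmerCorank 2 % 2 = W.analyticRank % 2 := hMon W
    rw [hs] at hpar
    by_contra hr
    rcases Nat.lt_or_ge W.analyticRank 2 with hlt | hge
    · omega
    · have hev : Even W.analyticRank := Nat.even_iff.mpr (by omega)
      have := h W hcm hm hev hge
      omega

/-- **Odd-rank form of the rank-`1` residual** (19220): modulo GZK (`hGZK`) and Monsky's `2`-parity (`hMon`),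
`RankOneTwoConverse` ⟺ every non-CM globally minimal `W`, good ordinary or multiplicative at `2`, of ODD analytic
rank `≥ 3` has `corank_{ℤ₂} Sel_{2^∞}(W/ℚ) ≥ 3`. (On even `r_an` corank `1` is excluded by parity alone; on `r_an = 1`
the residual is GZK.) [cite: DokchitserDokchitserAnnals2010, Thm. 1.4 and §4.6 (case p = 2)] [cite: Darmon2004, Thm. 3.22] -/
theorem rankOneTwoConverse_iff_three_le_selmerCorank_of_odd_analyticRank
    (hGZK : rank_eq_analyticRank_of_analyticRank_le_one) (hMon : monsky_selmerCorank_two_mod_two_eq) :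
    RankOneTwoConverse ↔
      ∀ (W : WeierstrassCurve ℚ) [W.IsElliptic] [W.IsGloballyMinimal], ¬ W.HasCM → (GoodOrd W 2 ∨ Mult W 2) →
        Odd W.analyticRank → 3 ≤ W.analyticRank → 3 ≤ W.selmerCorank 2 := by
  rw [rankOneTwoConverse_iff_selmerCorank_ne_one_of_two_le_analyticRank hGZK]
  constructor
  · intro h W _ _ hcm h2 hodd hr
    have hpar : W.selmerCorank 2 % 2 = W.analyticRank % 2 := hMon W
    have hodd' : W.analyticRank % 2 = 1 := Nat.odd_iff.mp hodd
    have hne := h W hcm h2 (by omega)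
    omega
  · intro h W _ _ hcm h2 hr hs
    have hpar : W.selmerCorank 2 % 2 = W.analyticRank % 2 := hMon W
    rw [hs] at hpar
    have hodd : Odd W.analyticRank := Nat.odd_iff.mpr (by omega)
    rcases Nat.lt_or_ge W.analyticRank 3 with hlt | hge
    · -- `r_an` odd and `2 ≤ r_an < 3` is impossible
      omega
    · have := h W hcm h2 hodd hge
      omega

/-- **The leaf with the locus split by parity**: modulo GZK and Monsky, `NonCMTwoConverse` ⟺ on the habitat, «even
`r_an ≥ 2` ⇒ corank `≥ 2`» AND «odd `r_an ≥ 3` ⇒ corank `≥ 3`». [cite: DokchitserDokchitserAnnals2010, Thm. 1.4 and §4.6 (case p = 2)]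
[cite: Darmon2004, Thm. 3.22] -/
theorem nonCMTwoConverse_iff_of_monsky
    (hGZK : rank_eq_analyticRank_of_analyticRank_le_one) (hMon : monsky_selmerCorank_two_mod_two_eq) :
    NonCMTwoConverse ↔
      (∀ (W : WeierstrassCurve ℚ) [W.IsElliptic] [W.IsGloballyMinimal], ¬ W.HasCM → (GoodOrd W 2 ∨ Mult W 2) →
          Even W.analyticRank → 2 ≤ W.analyticRank → 2 ≤ W.selmerCorank 2) ∧
        ∀ (W : WeierstrassCurve ℚ) [W.IsElliptic] [W.IsGloballyMinimal], ¬ W.HasCM → (GoodOrd W 2 ∨ Mult W 2) →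
          Odd W.analyticRank → 3 ≤ W.analyticRank → 3 ≤ W.selmerCorank 2 := by
  rw [nonCMTwoConverse_iff_two_le_selmerCorank_of_two_le_analyticRank hGZK]
  constructor
  · intro h
    refine ⟨fun W _ _ hcm h2 _ hr => h W hcm h2 hr, fun W _ _ hcm h2 hodd hr => ?_⟩
    have hpar : W.selmerCorank 2 % 2 = W.analyticRank % 2 := hMon W
    have hodd' : W.analyticRank % 2 = 1 := Nat.odd_iff.mp hodd
    have h2le := h W hcm h2 (by omega)
    omega
  · rintro ⟨hev, hodd⟩ W _ _ hcm h2 hr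
    rcases Nat.even_or_odd W.analyticRank with he | ho
    · exact hev W hcm h2 he hr
    · have hpar : W.selmerCorank 2 % 2 = W.analyticRank % 2 := hMon W
      have ho' : W.analyticRank % 2 = 1 := Nat.odd_iff.mp ho
      have h3 := hodd W hcm h2 ho (by omega)
      omega

/-! ## §3. The prime-conductor `2`-torsion family never meets the content locus -/

/-- **No S3 counterexample has prime conductor and a rational point of order `2`**: such a curve has `r_an = 0`
(GEN 23, Mazur 1977 II Thm. (18.10) via `hMz`, modularity `hmod`), so it is not in the content locus `{r_an ≥ 2}`.
[cite: Mazur1977, II Thm. (18.10) and Remark (p. 139)] [cite: BCDTJAMS2001, Thm. A] -/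
theorem not_two_le_analyticRank_of_prime_conductorNorm_of_hasRationalTwoTorsionX
    (hMz : Mazur1977_entireLFunction_one_ne_zero_of_prime_conductor_of_two_torsion)
    (hmod : nonempty_modularParametrizationData) (W : WeierstrassCurve ℚ) [W.IsElliptic] [W.IsGloballyMinimal]
    (hN : (W.conductorNorm ℤ).Prime) {x : ℚ} (hx : HasRationalTwoTorsionX W x) : ¬ 2 ≤ W.analyticRank := by
  haveI : NeZero (W.conductorNorm ℤ) := ⟨hN.ne_zero⟩
  obtain ⟨D⟩ := hmod W
  have hL : W.entireLFunction 1 ≠ 0 :=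
    hMz W hN ⟨D.f, D.isNewformOf⟩ ((exists_two_torsion_iff_exists_hasRationalTwoTorsionX' W).mpr ⟨x, hx⟩)
  rw [Literature.NumberTheory.EllipticCurves.analyticRank_eq_zero_of_entireLFunction_one_ne_zero W hL]
  omega

/-- **The locus form of the leaf holds on the prime-conductor `2`-torsion family** — vacuously in the hypothesis
`2 ≤ r_an` (so, unlike `TwoAdicPrimeConductor.nonCMTwoConverse_on_…`, without Kato): for `W` of prime conductor with a
rational point of order `2`, `2 ≤ r_an(W) → 2 ≤ corank_{ℤ₂} Sel_{2^∞}(W)`. [cite: Mazur1977, II Thm. (18.10) (p. 139)] -/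
theorem two_le_selmerCorank_of_two_le_analyticRank_of_prime_conductorNorm
    (hMz : Mazur1977_entireLFunction_one_ne_zero_of_prime_conductor_of_two_torsion)
    (hmod : nonempty_modularParametrizationData) (W : WeierstrassCurve ℚ) [W.IsElliptic] [W.IsGloballyMinimal]
    (hN : (W.conductorNorm ℤ).Prime) {x : ℚ} (hx : HasRationalTwoTorsionX W x) (hr : 2 ≤ W.analyticRank) :
    2 ≤ W.selmerCorank 2 :=
  absurd hr (not_two_le_analyticRank_of_prime_conductorNorm_of_hasRationalTwoTorsionX hMz hmod W hN hx)

end Summit.BirchSwinnertonDyer.BirchSwinnertonDyer.Theorems.TwoAdicContentLocus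

end
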